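import Summits.QuantumFields.BalabanUV.T4Continuum.Support.NE7LawLevelAssembly

/-!
# NE7, ROAD P4 (law-level), leaf (k1): TILT HYGIENE — two normalised positive densities against one reference measure
# are Gibbs tilts of each other; the FEEDER of the road's END without the binder `htilt`

(Cell `pub-balaban`, sub-cell `t4`, binder row NE7 = node U5, co-owner #4 `b2b-balaban-t4-ne7-p4`; skeleton
`HOME/t4/skeletons/NE7-t4-ne7-p4.md` §2 NODE P, leaf P.2 = swarm item (k1).  Files 1–2 of the road:
`NE7LawLevelSocket` p206810, `NE7LawLevelAssembly` p207170.)

HONEST FRAMING (T4-DAG PAGE 1).  Rung (B)+1 on ONE FIXED finite four-torus, CONDITIONAL on `BetaPertH` and the nine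
spine estimates (0/9 proved); NOT infinite volume, NOT a mass gap, NOT the Clay problem.  NE7 is NOT PRINTED and NOT
proved here.  This file is pure [folklore] measure theory (Mathlib `Measure.tilted` / `withDensity` algebra), sorry-free;
it discharges ONE HYGIENE binder of the road's FEEDER (`termMeanHybridSeq_of_leaves`), not an estimate.  NOT summit
progress.

WHAT IS PROVED.
* `tilted_normLawOf_eq` : for measurable `A, B > 0` with finite positive `vol`-integrals,
  `(normLawOf vol A).tilted (log B − log A) = normLawOf vol B` — the tilt relation the P3 lineage's `EffTermMeanHybrid`
  and this road's `TermMeanHybridSeq` ask as a clause (XREAD pv04-g24 I-3 «an instantiation from the FULL expansions must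
  supply it») is AUTOMATIC for two runs represented by everywhere-positive total densities (leaf P.1).
* `termMeanHybridSeq_of_leaves'` : the FEEDER with `htilt` DELETED (27 binders).
-/

noncomputable section

open MeasureTheory

namespace Summit.QuantumFields.BalabanUV.T4Continuum.NE7LawLevel

open Literature.MathematicalPhysics.QuantumFieldTheory.Balaban1983to89
open T4PathMeanHybrid

variable {X : Type*} [MeasurableSpace X]

/-- **Leaf (k1), TILT HYGIENE.**  Two normalised density laws of everywhere-positive measurable densities `A, B` with
finite positive integrals against one reference measure `vol` are Gibbs tilts of each other:
`(normLawOf vol A).tilted (log B − log A) = normLawOf vol B`.  (`∫ e^{log B − log A} d(normLawOf vol A) = (∫B)/(∫A)` is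
`T4PathMeanHybrid.integral_div_normDensity`; the rest is `withDensity` algebra.) [folklore] -/
theorem tilted_normLawOf_eq (vol : Measure X) {A B : X → ℝ} (hAm : Measurable A) (hBm : Measurable B)
    (hA : ∀ x, 0 < A x) (hB : ∀ x, 0 < B x) (hZA : 0 < ∫ x, A x ∂vol) (hZB : 0 < ∫ x, B x ∂vol) :
    (normLawOf vol A).tilted (fun x => Real.log (B x) - Real.log (A x)) = normLawOf vol B := by
  have hexp : ∀ x, Real.exp (Real.log (B x) - Real.log (A x)) = B x / A x := fun x => by
    rw [Real.exp_sub, Real.exp_log (hB x), Real.exp_log (hA x)]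
  have hint : ∫ x, B x / A x ∂(normLawOf vol A) = (∫ x, B x ∂vol) / ∫ x, A x ∂vol :=
    integral_div_normDensity vol B hAm hA
  unfold Measure.tilted
  simp_rw [hexp, hint]
  set ZA : ℝ := ∫ x, A x ∂vol with hZAdef
  set ZB : ℝ := ∫ x, B x ∂vol with hZBdef
  have hmeas : Measurable fun x => ENNReal.ofReal (B x / A x / (ZB / ZA)) :=
    ((hBm.div hAm).div_const (ZB / ZA)).ennreal_ofReal
  have hmul : (vol.withDensity fun x => ENNReal.ofReal (A x)).withDensity
        (fun x => ENNReal.ofReal (B x / A x / (ZB / ZA))) =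
      vol.withDensity ((fun x => ENNReal.ofReal (A x)) * fun x => ENNReal.ofReal (B x / A x / (ZB / ZA))) :=
    (withDensity_mul _ hAm.ennreal_ofReal hmeas).symm
  have hfun : ((fun x => ENNReal.ofReal (A x)) * fun x => ENNReal.ofReal (B x / A x / (ZB / ZA))) =
      ENNReal.ofReal (ZA / ZB) • fun x => ENNReal.ofReal (B x) := by
    funext x
    simp only [Pi.mul_apply, Pi.smul_apply, smul_eq_mul]
    rw [← ENNReal.ofReal_mul (hA x).le, ← ENNReal.ofReal_mul (div_pos hZA hZB).le]
    congr 1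
    have hAx : A x ≠ 0 := (hA x).ne'
    have hZA0 : ZA ≠ 0 := hZA.ne'
    have hZB0 : ZB ≠ 0 := hZB.ne'
    field_simp
  unfold normLawOf
  rw [withDensity_smul_measure, ← hZAdef, ← hZBdef, hmul, hfun, withDensity_smul _ hBm.ennreal_ofReal, smul_smul]
  congr 1
  rw [ENNReal.ofReal_div_of_pos hZB, div_eq_mul_inv, ← mul_assoc,
    ENNReal.inv_mul_cancel ((ENNReal.ofReal_pos.mpr hZA).ne') ENNReal.ofReal_ne_top, one_mul]

/-- **THE FEEDER WITHOUT `htilt`**: the leaves P (positivity / representation), S, D, W of the road give the term-wise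
socket, the tilt relation being supplied by `tilted_normLawOf_eq`. [folklore] -/
theorem termMeanHybridSeq_of_leaves' {κ : Type*} (kinds : Finset κ) (ρ : κ → ℕ → ℝ)
    (hρ0 : ∀ i ∈ kinds, ∀ K, 0 ≤ ρ i K) (vol : Measure X) (ν : ℕ → Measure X)
    (T : ℕ → Finset ℕ) (Bad : ℕ → ℝ → Finset ℕ) (a b : ℕ → ℕ → X → ℝ) (c : ℕ → ℝ) (Sa Sb : ℕ → Set X)
    {l₀ : ℝ} (hl₀ : 0 ≤ l₀) {A B : ℕ → ℝ → ℕ → ℝ} {W sA sB : ℕ → ℝ}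
    (ham : ∀ K, ∀ τ ∈ T K, Measurable (a K τ)) (hbm : ∀ K, ∀ τ ∈ T K, Measurable (b K τ))
    (ha0 : ∀ K u, ∀ τ ∈ T K, 0 ≤ a K τ u) (hb0 : ∀ K u, ∀ τ ∈ T K, 0 ≤ b K τ u)
    (hapos : ∀ K u, 0 < ∑ τ ∈ T K, a K τ u) (hbpos : ∀ K u, 0 < ∑ τ ∈ T K, b K τ u)
    (hai : ∀ K, ∀ τ ∈ T K, Integrable (a K τ) vol) (hbi : ∀ K, ∀ τ ∈ T K, Integrable (b K τ) vol)
    (hZa : ∀ K, 0 < ∑ τ ∈ T K, ∫ x, a K τ x ∂vol) (hZb : ∀ K, 0 < ∑ τ ∈ T K, ∫ x, b K τ x ∂vol)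
    (hνA : ∀ K, ν K = normLawOf vol fun x => ∑ τ ∈ T K, a K τ x)
    (hνB : ∀ K, ν (K + 1) = normLawOf vol fun x => ∑ τ ∈ T K, b K τ x)
    (hSa : ∀ K, MeasurableSet (Sa K)) (hSb : ∀ K, MeasurableSet (Sb K))
    (hlow : ∀ K, ∀ u ∈ Sa K, ∀ τ ∈ T K \ Bad K 0,
      Real.exp (c K - totalRadius kinds ρ K) * a K τ u ≤ b K τ u)
    (hup : ∀ K, ∀ u ∈ Sb K, ∀ τ ∈ T K \ Bad K 0,
      b K τ u ≤ Real.exp (c K + totalRadius kinds ρ K) * a K τ u)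
    (hcA : ∀ K, (ν K).real (Sa K)ᶜ ≤ sA K) (hcB : ∀ K, (ν (K + 1)).real (Sb K)ᶜ ≤ sB K)
    (hRW : T4WeightBudget.RelWeightBound l₀ T A B Bad W)
    (hAK : ∀ K, ∀ τ ∈ T K, A K 0 τ = ∫ x, a K τ x ∂vol) (hBK : ∀ K, ∀ τ ∈ T K, B K 0 τ = ∫ x, b K τ x ∂vol) :
    TermMeanHybridSeq ν (totalRadius kinds ρ) (fun K => W K + sA K) (fun K => W K + sB K) := by
  have htilt : ∀ K, ν (K + 1) =
      (ν K).tilted (fun u => Real.log (∑ τ ∈ T K, b K τ u) - Real.log (∑ τ ∈ T K, a K τ u)) := by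
    intro K
    have hZa' : 0 < ∫ x, ∑ τ ∈ T K, a K τ x ∂vol := by rw [integral_finsetSum _ (hai K)]; exact hZa K
    have hZb' : 0 < ∫ x, ∑ τ ∈ T K, b K τ x ∂vol := by rw [integral_finsetSum _ (hbi K)]; exact hZb K
    rw [hνA K, hνB K, tilted_normLawOf_eq vol (Finset.measurable_sum _ (ham K)) (Finset.measurable_sum _ (hbm K))
      (hapos K) (hbpos K) hZa' hZb']
  exact termMeanHybridSeq_of_leaves kinds ρ hρ0 vol ν T Bad a b c Sa Sb hl₀ ham hbm ha0 hb0 hapos hbpos hai hbi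
    hZa hZb hνA hνB htilt hSa hSb hlow hup hcA hcB hRW hAK hBK

end Summit.QuantumFields.BalabanUV.T4Continuum.NE7LawLevel

end
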